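import Summits.ResolutionOfSingularities.ResolutionOfSingularities.Theorems.HilbertSamuelEliminationSigmaMaxModificationsCorridor3WLadderRecognitionNearLocusWUnit
import Summits.ResolutionOfSingularities.ResolutionOfSingularities.Theorems.HilbertSamuelEliminationCampaignW42NearPointRationalBinder
import Literature.AlgebraicGeometry.CossartJannsenSaito2020.NearFibreNormalDirectrix
import Literature.AlgebraicGeometry.CossartJannsenSaito2020.NearPointDirectrix
import Literature.AlgebraicGeometry.CossartJannsenSaito2020.NearPointProjDirectrix
import HarnessLib

/-!
# [OURS · L1 W4.2] RECOGNITION-GEOMETRY (R2), WAITING-TOLERANT FORM: THE (F1) INSTANCE — the characteristic row `stub_Wlow3M_char`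
# (crux chain w42, line `w_ladder`; `--supports stmt-…-19249`, helper)

OURS (cell res-hironaka, slot W4.2, seat res-L1-w42-stub-2 gen 4); NOT statements of H. Hironaka's manuscript [Hironaka2017]
nor of [CossartJannsenSaito2020]. AI-drafted, weaker than expert review. Sorry-free PROOF file (no new definition).

The waiting-tolerant F-parametric (R2) (`…RecognitionNearLocusW{Fibres,Curve,Shape,Unit}`) INSTANTIATED at `F := CharHypothesis` (CJS's
(F1) «`char κ = 0 ∨ char κ ≥ dim X/2 + 1`»), the point hypothesis of the row `stub_Wlow3M_char` — companion of `…RecognitionNearLocusGeomDir`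
(the (F1♯) instance). Binders = PRINTED FACTS BY NAME: `Thm314_nearFibre_subsingleton` (h314f), `CossartJannsenSaito2020_thm_3_14` (h314,
through the 1-line adapter `thm_3_14_binder` adding the unused instance `[IsLocallyNoetherian X']`), `Thm314_point_locus` (h314pt) and
res-L1-s42-pv-1's P-b door `CampaignW42.isIso_residueFieldMap_of_near_of_charHypothesis h314pt` (hPb), CJS Thm. 3.6 (`h36`, F-65),
Thm. 3.10 (4) (`h3104`), P-a PROVED (`ProjDir_projLine_holds`).

* `charHypothesis_of_mem_nearLocus` — the standing hypothesis `hF` from (F1) at `x` ((F1) travels up the fibre,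
  `BlowupTowerNear.charHypothesis_of_over`);
* `thm_3_14_binder` — the printed numerical Thm. 3.14 in the binder shape `h314` of the W-files;
* **`dichPlus_nearLocus_succ_char`**, **`inducesIsoOn_of_unit_char`**, **`dichPlus_of_unit_char`**, **`not_surjective_of_unit_char`** — (Dich⁺),
  CJS Def. 6.38 (iv) and (v) for the characteristic row, printed facts only (for res-D-pv-038's assembly `unitGeometryAtQM_of_doors`,
  RULING v3.14-19 (FK)).

## References

* V. Cossart, U. Jannsen, S. Saito, LNM 2270 (2020): Thm. 3.6, Thm. 3.10 (4), Thm. 3.14, Def. 6.38 (ii)–(v), p. 94, pp. 103–105.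
  [CossartJannsenSaito2020]
-/

noncomputable section

-- namespace `…Corridor3.Helpers` re-enters `…Corridor3`
set_option linter.dupNamespace false

open CategoryTheory AlgebraicGeometry TopologicalSpace IsLocalRing
open Literature.AlgebraicGeometry.Resolution
open Scheme.IdealSheafData

universe u

open Literature.AlgebraicGeometry.CossartJannsenSaito2020
open Summit.ResolutionOfSingularities.ResolutionOfSingularities.Theorems.CampaignW42

namespace Summit.ResolutionOfSingularities.ResolutionOfSingularities.Theorems.SigmaMaxModificationsCorridor3.Helpers

namespace BlowupTowerNearChar

variable (T : BlowupTower.{u}) {N : ℕ}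

/-! ## §1. (F1) at every point over `x` -/

/-- **(F1) at every near point** from (F1) at `x`: the residue characteristic is read through `κ(x) → κ(y)` and the dimension does not go
up (`BlowupTowerNear.charHypothesis_of_over`) — the standing hypothesis `hF` of the W-files for `F := CharHypothesis`.
[cite: CossartJannsenSaito2020, Thm. 10.2] -/
theorem charHypothesis_of_mem_nearLocus {x : T.X 0} (hchar : CharHypothesis (T.X 0) x) :
    ∀ i, ∀ y ∈ T.nearLocus N x i, CharHypothesis (T.X i) y :=
  fun i y hy => BlowupTowerNear.charHypothesis_of_over T i y (hy.1.symm ▸ hchar)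

/-! ## §2. The printed numerical Thm. 3.14 in binder shape -/

/-- The printed `CossartJannsenSaito2020_thm_3_14` in the binder shape `h314` of the W-files (which carries an unused
`[IsLocallyNoetherian X']`). [cite: CossartJannsenSaito2020, Thm. 3.14] -/
theorem thm_3_14_binder (h314 : CossartJannsenSaito2020_thm_3_14.{u}) :
    ∀ (X X' : Scheme.{u}) [IsLocallyNoetherian X] [IsLocallyNoetherian X'] (π : X' ⟶ X) (D : X.IdealSheafData),
      Scheme.IsExcellent X → IdealSheafData.IsPermissible D → IsBlowup π D →
        ∀ N : ℕ, topologicalKrullDim X ≤ (N : WithBot ℕ∞) →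
          ∀ x' : X', π.base x' ∈ D.support → CharHypothesis X (π.base x') →
            Scheme.hsFun X' N x' = Scheme.hsFun X N (π.base x') →
              ringKrullDim (X.presheaf.stalk (π.base x') ⧸ stalkIdeal D (π.base x')) <
                (Scheme.dirDim X (π.base x') : WithBot ℕ∞) :=
  fun X X' _ _ π D hX hD hπ N hN x' hx' hc hnear => h314 X X' π D hX hD hπ N hN x' hx' hc hnear

/-! ## §3. The unit-level clauses in the (F1) regime -/

section UnitChar

variable {T}

/-- **CJS Def. 6.38 (iv) in the (F1) regime (row `stub_Wlow3M_char`)**: for a tower with `X_0` noetherian excellent (`N ≥ dim`),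
(F1) at `x`, permissible centres, closed strata, `C_0 = {x}` (`x` closed, `e_x = 2`, `ē_x ≤ 2`), `C_1 = ℙ(Dir_x)`, `N_1(x) ≠ ∅`,
`C_i = N_i(x)` (`2 ≤ i ≤ q`), a CLOSED near point NOT isolated in `N_i(x)` at every `2 ≤ i ≤ q`: **`π_{j+1} : C_{j+1} ⥲ C_j` for all
`1 ≤ j`, `j + 1 ≤ q`** — modulo the PRINTED facts `Thm314_nearFibre_subsingleton`, `CossartJannsenSaito2020_thm_3_14`,
`Thm314_point_locus`, CJS Thm. 3.6, Thm. 3.10 (4) (and P-a proved). [cite: CossartJannsenSaito2020, Def. 6.38 (ii)–(iv), p. 104] -/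
theorem inducesIsoOn_of_unit_char [IsNoetherian (T.X 0)] (h314f : Thm314_nearFibre_subsingleton.{u})
    (h314 : CossartJannsenSaito2020_thm_3_14.{u}) (h314pt : Thm314_point_locus.{u}) (h36 : CossartJannsenSaito2020_thm_3_6.{u})
    (h3104 : CossartJannsenSaito2020_thm_3_10_4.{u}) (hkey : KeySetting T N)
    (hperm : ∀ j, IdealSheafData.IsPermissible (T.centreIdeal j))
    (hcl : ∀ (j : ℕ) (μ : ℕ → ℕ), IsClosed (Scheme.hsStratumGE (T.X j) N μ))
    {x : T.X 0} (hx : IsClosed ({x} : Set (T.X 0))) (hchar : CharHypothesis (T.X 0) x) (he : T.dirDimAt 0 x = 2)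
    (hē : T.geomDirDimAt 0 x ≤ 2)
    (hC0 : T.C 0 = {x}) (hC1 : T.C 1 = T.projDir x) (hN1 : (T.nearLocus N x 1).Nonempty)
    {q : ℕ} (hCq : ∀ i, 2 ≤ i → i ≤ q → T.C i = T.nearLocus N x i)
    (hniso : ∀ i, 2 ≤ i → i ≤ q → ∃ z ∈ T.nearLocus N x i, IsClosed ({z} : Set (T.X i)) ∧
      ¬ ∃ U : Set (T.X i), IsOpen U ∧ U ∩ T.nearLocus N x i = {z}) :
    ∀ j, 1 ≤ j → j + 1 ≤ q → InducesIsoOn (T.π j) (T.C (j + 1)) (T.isClosed_C (j + 1)) (T.C j) (T.isClosed_C j) :=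
  BlowupTowerNearW.inducesIsoOn_of_unit (fun X _ y => CharHypothesis X y) h314f
    (isIso_residueFieldMap_of_near_of_charHypothesis h314pt) (thm_3_14_binder h314) h314pt h36 h3104 hkey hperm hcl hx
    (charHypothesis_of_mem_nearLocus T hchar) he hē hC0 hC1 hN1 hCq hniso

/-- **(Dich⁺) in the (F1) regime** at every stage `1 ≤ j ≤ q` (hypotheses of `inducesIsoOn_of_unit_char`): `N_{j+1}(x)` is EITHER
irreducible, nontrivial, with a non-closed point, and regular (reduced structure), OR a finite set of closed points — stub-1's
(Dich)/(RegN) inputs for the characteristic row (transfer to the global stages by `…RecognitionNearLocusLocalize`).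
[cite: CossartJannsenSaito2020, Def. 6.38 (iii)–(iv), p. 94, p. 104] -/
theorem dichPlus_of_unit_char [IsNoetherian (T.X 0)] (h314f : Thm314_nearFibre_subsingleton.{u})
    (h314 : CossartJannsenSaito2020_thm_3_14.{u}) (h314pt : Thm314_point_locus.{u}) (h36 : CossartJannsenSaito2020_thm_3_6.{u})
    (h3104 : CossartJannsenSaito2020_thm_3_10_4.{u}) (hkey : KeySetting T N)
    (hperm : ∀ j, IdealSheafData.IsPermissible (T.centreIdeal j))
    (hcl : ∀ (j : ℕ) (μ : ℕ → ℕ), IsClosed (Scheme.hsStratumGE (T.X j) N μ))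
    {x : T.X 0} (hx : IsClosed ({x} : Set (T.X 0))) (hchar : CharHypothesis (T.X 0) x) (he : T.dirDimAt 0 x = 2)
    (hē : T.geomDirDimAt 0 x ≤ 2)
    (hC0 : T.C 0 = {x}) (hC1 : T.C 1 = T.projDir x) (hN1 : (T.nearLocus N x 1).Nonempty)
    {q : ℕ} (hCq : ∀ i, 2 ≤ i → i ≤ q → T.C i = T.nearLocus N x i)
    (hniso : ∀ i, 2 ≤ i → i ≤ q → ∃ z ∈ T.nearLocus N x i, IsClosed ({z} : Set (T.X i)) ∧
      ¬ ∃ U : Set (T.X i), IsOpen U ∧ U ∩ T.nearLocus N x i = {z})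
    {j : ℕ} (hj : 1 ≤ j) (hjq : j ≤ q) :
    (IsIrreducible (T.nearLocus N x (j + 1)) ∧ (T.nearLocus N x (j + 1)).Nontrivial ∧
        (∃ z ∈ T.nearLocus N x (j + 1), ¬ IsClosed ({z} : Set (T.X (j + 1)))) ∧
        ∀ hN : IsClosed (T.nearLocus N x (j + 1)),
          Scheme.IsRegular (vanishingIdeal (⟨T.nearLocus N x (j + 1), hN⟩ : Closeds (T.X (j + 1)))).subscheme) ∨
      ((T.nearLocus N x (j + 1)).Finite ∧ ∀ z ∈ T.nearLocus N x (j + 1), IsClosed ({z} : Set (T.X (j + 1)))) :=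
  BlowupTowerNearW.dichPlus_of_unit (fun X _ y => CharHypothesis X y) h314f
    (isIso_residueFieldMap_of_near_of_charHypothesis h314pt) (thm_3_14_binder h314) h314pt h36 h3104 hkey hperm hcl hx
    (charHypothesis_of_mem_nearLocus T hchar) he hē hC0 hC1 hN1 hCq hniso hj hjq

/-- **CJS Def. 6.38 (v) in the (F1) regime**: `¬ (C_q ⊆ π_{q+1}(N_{q+1}(x)))` given in addition an ISOLATED closed point of `N_{q+1}(x)`
(the marked point at the terminal `Iso` stage). [cite: CossartJannsenSaito2020, Def. 6.38 (v), p. 105] -/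
theorem not_surjective_of_unit_char [IsNoetherian (T.X 0)] (h314f : Thm314_nearFibre_subsingleton.{u})
    (h314pt : Thm314_point_locus.{u}) (h36 : CossartJannsenSaito2020_thm_3_6.{u})
    (h3104 : CossartJannsenSaito2020_thm_3_10_4.{u}) (hkey : KeySetting T N)
    (hperm : ∀ j, IdealSheafData.IsPermissible (T.centreIdeal j))
    (hcl : ∀ (j : ℕ) (μ : ℕ → ℕ), IsClosed (Scheme.hsStratumGE (T.X j) N μ))
    {x : T.X 0} (hx : IsClosed ({x} : Set (T.X 0))) (hchar : CharHypothesis (T.X 0) x) (he : T.dirDimAt 0 x = 2)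
    (hē : T.geomDirDimAt 0 x ≤ 2)
    (hC0 : T.C 0 = {x}) (hC1 : T.C 1 = T.projDir x) (hN1 : (T.nearLocus N x 1).Nonempty)
    {q : ℕ} (hq : 1 ≤ q) (hCq : ∀ i, 2 ≤ i → i ≤ q → T.C i = T.nearLocus N x i)
    (hniso : ∀ i, 2 ≤ i → i ≤ q → ∃ z ∈ T.nearLocus N x i, IsClosed ({z} : Set (T.X i)) ∧
      ¬ ∃ U : Set (T.X i), IsOpen U ∧ U ∩ T.nearLocus N x i = {z})
    {z : T.X (q + 1)} (hzcl : IsClosed ({z} : Set (T.X (q + 1))))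
    (hiso : ∃ U : Set (T.X (q + 1)), IsOpen U ∧ U ∩ T.nearLocus N x (q + 1) = {z}) :
    ¬ (T.C q ⊆ (T.π q).base '' T.nearLocus N x (q + 1)) :=
  BlowupTowerNearW.not_surjective_of_unit (fun X _ y => CharHypothesis X y) h314f h314pt h36 h3104 hkey hperm hcl hx
    (charHypothesis_of_mem_nearLocus T hchar) he hē hC0 hC1 hN1 hq hCq hniso hzcl hiso

/-- **(Dich⁺) at ONE step in the (F1) regime** (for stub-1's interleaved induction): standing hypotheses of the F-files at stage `j`
(`N_j(x) ⊆ C_j ⊆ N_j(x)`, `C_j` irreducible, nontrivial, non-generic points closed). [cite: CossartJannsenSaito2020, p. 94, p. 104] -/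
theorem dichPlus_nearLocus_succ_char [IsNoetherian (T.X 0)] (h314f : Thm314_nearFibre_subsingleton.{u})
    (h314 : CossartJannsenSaito2020_thm_3_14.{u}) (h314pt : Thm314_point_locus.{u}) (h36 : CossartJannsenSaito2020_thm_3_6.{u})
    (h3104 : CossartJannsenSaito2020_thm_3_10_4.{u}) (hkey : KeySetting T N)
    (hperm : ∀ j, IdealSheafData.IsPermissible (T.centreIdeal j))
    (hcl : ∀ (j : ℕ) (μ : ℕ → ℕ), IsClosed (Scheme.hsStratumGE (T.X j) N μ))
    {x : T.X 0} (hx : IsClosed ({x} : Set (T.X 0))) (hchar : CharHypothesis (T.X 0) x) (hē : T.geomDirDimAt 0 x ≤ 2) {j : ℕ}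
    (hNC : T.nearLocus N x j ⊆ T.C j) (hCN : T.C j ⊆ T.nearLocus N x j)
    (hirr : IsIrreducible (T.C j)) (hnt : (T.C j).Nontrivial)
    (hpts : ∀ y ∈ T.C j, ¬ IsGenericPoint y (T.C j) → IsClosed ({y} : Set (T.X j))) :
    (IsIrreducible (T.nearLocus N x (j + 1)) ∧ (T.nearLocus N x (j + 1)).Nontrivial ∧
        (∃ z ∈ T.nearLocus N x (j + 1), ¬ IsClosed ({z} : Set (T.X (j + 1)))) ∧
        ∀ hN : IsClosed (T.nearLocus N x (j + 1)),
          Scheme.IsRegular (vanishingIdeal (⟨T.nearLocus N x (j + 1), hN⟩ : Closeds (T.X (j + 1)))).subscheme) ∨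
      ((T.nearLocus N x (j + 1)).Finite ∧ ∀ z ∈ T.nearLocus N x (j + 1), IsClosed ({z} : Set (T.X (j + 1)))) :=
  BlowupTowerNearW.dichPlus_nearLocus_succ (fun X _ y => CharHypothesis X y) h314f
    (isIso_residueFieldMap_of_near_of_charHypothesis h314pt) (thm_3_14_binder h314) h36 h3104 hkey hperm hcl hx
    (charHypothesis_of_mem_nearLocus T hchar) hē hNC hCN hirr hnt hpts

end UnitChar

end BlowupTowerNearChar

end Summit.ResolutionOfSingularities.ResolutionOfSingularities.Theorems.SigmaMaxModificationsCorridor3.Helpers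

end
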